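import Summits.MatrixMultiplication.MatrixMultiplication.Theses.TropicalBiniPatterns
import Literature.Computability.AlgebraicComplexity.BorderApolarityCandidates
import Literature.Computability.AlgebraicComplexity.StrassenMinimalBorderRank
import Literature.Computability.AlgebraicComplexity.BorderRankRestriction
import Summits.MatrixMultiplication.MatrixMultiplication.Theorems.TropicalBiniPatternsSchonhageTightTwoTwoCert

/-!
# TropicalBiniPatterns / `SchonhageTightTwoTwo` (stmt-MatrixMultiplication-8009), part 2:
# `bR(⟨2,1,2⟩ ⊕ ⟨1,2,1⟩) ≥ 6` — Schönhage's single free scalar product is optimal at `(k,n) = (2,2)`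

Route `MatrixMultiplication/TropicalBiniPatterns`, support item `SchonhageTightTwoTwo`:
`6 ≤ algBorderRank (matMulDirectSum ℂ ![2,1] ![1,2] ![2,1])`, i.e. the direct sum of the outer
product of two `2`-vectors and an inner product of length `2` (format `5 × 4 × 4`, concise, rank `6`,
Koszul-flattening bound only `5`) has border rank exactly `6` over `ℂ[ε]`; the kissing cell
`(k,n) = (2,2)` of the crux `KissingBeyondSchonhage` is negative.

## Proof (elementary border apolarity, span side, `(210)`-test; valid over every field)

Write `T ∈ A ⊗ U ⊗ V`, `A = K⁵ ∋ c₁₁,c₁₂,c₂₁,c₂₂,z`, `U = K⁴ ∋ a₁,a₂,x₁,x₂`, `V = K⁴ ∋ b₁,b₂,y₁,y₂`,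
`T = ∑ c_{jk} ⊗ a_j ⊗ b_k + z ⊗ (x₁ ⊗ y₁ + x₂ ⊗ y₂)` (`T221` of part 1, a coordinate restriction of the
tree's `matMulDirectSum`, so `bR(T221) ≤ bR(matMulDirectSum …)` by `algBorderRank_precomp_le`).  If
`bR(T) ≤ 5`, an order-`h` decomposition with `5` triads exists, and the tree's torus-fixed weak border
apolarity (`BorderApolarity.exists_graded_candidate_of_isApproxDecomposition`, Conner–Harper–Landsberg
2023 §2.3–2.4 made elementary) yields a subspace `E ⊆ K^{A × U}` with `dim E ≤ 5`, containing the four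
`V`-slices `P = T(V^*) = ⟨c₁ₖ ⊗ a₁ + c₂ₖ ⊗ a₂, z ⊗ x_i⟩` (`dim P = 4`), graded for the weights
`eA = (1,4,0,3,6)`, `eB = (0,1,8,16)`, and whose `(210)`-test space `(A ⊗ E) ∩ (S²A ⊗ U)` has
dimension `≥ 5`.  Gradedness forces `E = P` or `E = P ⊕ K x'` with `x'` a weight vector, hence
`E ≤ Eeq K c` for one of `20` explicit equational subspaces (`exists_le_Eeq`), and each of those has
`(210)`-test dimension `≤ 4` (`finrank_testI_Eeq_le`: the test space is cut out by binomial equations,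
so a vector in it vanishing at `4` well-chosen coordinates vanishes identically by the kernel-checked
zero propagation of part 1) — contradiction.  (By hand one checks that EVERY line `ℓ` gives
`dim (A ⊗ (P + ℓ)) ∩ (S²A ⊗ U) ≤ 4`; the torus reduction only makes the verification finite.)
-/

set_option linter.dupNamespace false

namespace Summit.MatrixMultiplication.MatrixMultiplication.Theorems

namespace SchonhageTightTwoTwo

open Literature.Computability.AlgebraicComplexity
open Literature.Computability.AlgebraicComplexity.BorderApolarity
open scoped BigOperators

/-! ## Soundness of the certificate checker -/

/-- Soundness of `checkFrom`: if `ok s seen` guarantees `P s` whenever `P` holds on `seen`, a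
successful run from a duplicate-free `seen ⊆ [0,100)` on which `P` holds ends with `P` on a
duplicate-free list of length `100` inside `[0,100)`. -/
theorem checkFrom_sound (ok : ℕ → List ℕ → Bool) (P : ℕ → Prop)
    (hok : ∀ s seen, s < 100 → (∀ t ∈ seen, P t) → ok s seen = true → P s) :
    ∀ (L seen : List ℕ), checkFrom ok seen L = true → (∀ t ∈ seen, P t) → seen.Nodup →
      (∀ t ∈ seen, t < 100) →
      ∃ final : List ℕ, (∀ t ∈ final, P t) ∧ final.Nodup ∧ (∀ t ∈ final, t < 100) ∧
        final.length = 100 := by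
  intro L
  induction L with
  | nil =>
    intro seen h hP hnd hlt
    refine ⟨seen, hP, hnd, hlt, ?_⟩
    simpa [checkFrom] using h
  | cons s rest ih =>
    intro seen h hP hnd hlt
    simp only [checkFrom, Bool.and_eq_true, decide_eq_true_eq, Bool.not_eq_true'] at h
    obtain ⟨⟨⟨hs, hnew⟩, hoks⟩, hrest⟩ := h
    have hsn : s ∉ seen := by
      intro hmem
      have : seen.elem s = true := List.elem_eq_true_of_mem hmem
      rw [hnew] at this
      exact Bool.false_ne_true this
    have hPs : P s := hok s seen hs hP hoks
    refine ih (s :: seen) hrest ?_ (List.nodup_cons.2 ⟨hsn, hnd⟩) ?_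
    · intro t ht
      rcases List.mem_cons.1 ht with rfl | ht
      · exact hPs
      · exact hP t ht
    · intro t ht
      rcases List.mem_cons.1 ht with rfl | ht
      · exact hs
      · exact hlt t ht

/-- A duplicate-free list of length `100` inside `[0,100)` contains every `s < 100`. -/
theorem mem_of_nodup_of_length {final : List ℕ} (hnd : final.Nodup) (hlt : ∀ t ∈ final, t < 100)
    (hlen : final.length = 100) {s : ℕ} (hs : s < 100) : s ∈ final := by
  classical
  have hsub : final.toFinset ⊆ Finset.range 100 := by
    intro t ht
    exact Finset.mem_range.2 (hlt t (List.mem_toFinset.1 ht))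
  have hcard : (Finset.range 100).card ≤ final.toFinset.card := by
    rw [Finset.card_range, List.toFinset_card_of_nodup hnd, hlen]
  have heq : final.toFinset = Finset.range 100 := Finset.eq_of_subset_of_card_le hsub hcard
  exact List.mem_toFinset.1 (heq ▸ Finset.mem_range.2 hs)

/-- **Soundness of `checkN`.** If a property `P` of coordinates `< 100` holds at the zero-condition
coordinates and at the four evaluation coordinates of candidate `c`, and is transported backwards
along the symmetry move and along the active tie moves, then a successful check gives `P`
everywhere. -/
theorem forall_of_checkN {c : ℕ} (hc : checkN c = true) (P : ℕ → Prop)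
    (hz : ∀ s < 100, zcondN c (s % 20) = true → P s)
    (hev : ∀ i < 4, evN c i < 100 → P (evN c i))
    (hsym : ∀ s < 100, P (symN s) → P s)
    (ht1 : (degN c == 1) = false → ∀ s < 100, P (tie1N s) → P s)
    (ht2 : (degN c == 4) = false → ∀ s < 100, P (tie2N s) → P s) :
    ∀ s < 100, P s := by
  have hok : ∀ s seen, s < 100 → (∀ t ∈ seen, P t) → okN c s seen = true → P s := by
    intro s seen hs hseen h
    simp only [okN, Bool.or_eq_true, Bool.and_eq_true, Bool.not_eq_true', List.any_eq_true,
      beq_iff_eq] at h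
    rcases h with (((h | ⟨i, hi, his⟩) | h) | ⟨h1, h⟩) | ⟨h2, h⟩
    · exact hz s hs h
    · rw [← his]
      exact hev i (List.mem_range.1 hi) (his ▸ hs)
    · exact hsym s hs (hseen _ (List.mem_of_elem_eq_true h))
    · exact ht1 h1 s hs (hseen _ (List.mem_of_elem_eq_true h))
    · exact ht2 h2 s hs (hseen _ (List.mem_of_elem_eq_true h))
  obtain ⟨final, hP, hnd, hlt, hlen⟩ :=
    checkFrom_sound (okN c) P hok _ [] hc (by simp) List.nodup_nil (by simp)
  intro s hs
  exact hP s (mem_of_nodup_of_length hnd hlt hlen hs)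

/-! ## The `(210)`-test of the candidates has dimension `≤ 4` -/

/-- **An element of the `(210)`-test space `(A ⊗ E_c) ∩ (S²A ⊗ U)` of `E_c` vanishing at the four
evaluation coordinates is zero** (for every code `c` whose certificate checks): all its defining
equations are binomial, and the derivation list links every coordinate to a forced zero. -/
theorem eq_zero_of_mem_testI {K : Type*} [Field K] {c : ℕ} (hc : checkN c = true)
    {y : Fin 5 × Fin 5 × Fin 4 → K} (hy : y ∈ testI (Eeq K c))
    (hev : ∀ i : Fin 4, y (decT (evN c i)) = 0) : y = 0 := by
  obtain ⟨hs, hsl⟩ := Submodule.mem_inf.1 hy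
  rw [mem_slicesI] at hsl
  have hsym : ∀ a a' u, y (a, a', u) = y (a', a, u) := (mem_symA K).1 hs
  have hsl' : ∀ a₀, (fun ab : Fin 5 × Fin 4 => y (a₀, ab.1, ab.2)) ∈ Eeq K c := fun a₀ => hsl a₀
  have key := forall_of_checkN hc (fun n => y (decT n) = 0) ?_ ?_ ?_ ?_ ?_
  · funext s
    rw [← decT_codeT s]
    exact key _ (codeT_lt s)
  · intro n hn hz
    have h := (mem_Eeq.1 (hsl' (decT n).1)).1 (decT n).2 (by rw [codeP_decT n hn]; exact hz)
    simpa using h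
  · intro i hi _
    exact hev ⟨i, hi⟩
  · intro n hn h
    rw [decT_symN n hn] at h
    rw [← h]
    exact hsym _ _ _
  · intro h1 n hn h
    rcases decT_tie1N n hn with e | ⟨a, e1, e2⟩ | ⟨a, e1, e2⟩
    · rwa [e] at h
    · rw [e1]; rw [e2] at h
      exact ((mem_Eeq.1 (hsl' a)).2.1 h1).trans h
    · rw [e1]; rw [e2] at h
      exact ((mem_Eeq.1 (hsl' a)).2.1 h1).symm.trans h
  · intro h2 n hn h
    rcases decT_tie2N n hn with e | ⟨a, e1, e2⟩ | ⟨a, e1, e2⟩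
    · rwa [e] at h
    · rw [e1]; rw [e2] at h
      exact ((mem_Eeq.1 (hsl' a)).2.2 h2).trans h
    · rw [e1]; rw [e2] at h
      exact ((mem_Eeq.1 (hsl' a)).2.2 h2).symm.trans h

variable (K : Type*) [Field K]

/-- **`dim (A ⊗ E_c) ∩ (S²A ⊗ U) ≤ 4`** for every code `c` whose certificate checks (all `c < 20` by
`checkN_all`): evaluation at the four coordinates `evN c i` is an injective linear map to `K⁴`. -/
theorem finrank_testI_Eeq_le {c : ℕ} (hc : checkN c = true) :
    Module.finrank K (testI (Eeq K c)) ≤ 4 := by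
  let f : testI (Eeq K c) →ₗ[K] (Fin 4 → K) :=
    { toFun := fun y i => (y : Fin 5 × Fin 5 × Fin 4 → K) (decT (evN c i))
      map_add' := fun _ _ => rfl
      map_smul' := fun _ _ => rfl }
  have hf : Function.Injective f := by
    rw [← LinearMap.ker_eq_bot, LinearMap.ker_eq_bot']
    intro y hy
    apply Subtype.ext
    exact eq_zero_of_mem_testI hc y.2 (fun i => congr_fun hy i)
  have h := LinearMap.finrank_le_finrank_of_injective hf
  simpa using h

/-! ## `P`, the torus weights and the reduction to the twenty candidates -/

/-- The integer degree used by the torus argument is `degN` of the code. -/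
theorem degIK_eq (p : Fin 5 × Fin 4) : degIK eAF eBF p = (degN (codeP p) : ℤ) := by
  rw [degN_codeP]; rfl

/-- Every `V`-slice of `T` is a weight vector (of weight `nvec v`). -/
theorem T221_homogeneous : ∀ v : Fin 4, ∃ n : ℕ, ∀ (a : Fin 5) (u : Fin 4), T221 K a u v ≠ 0 →
    eAF a + eBF u = n := by
  intro v
  refine ⟨nvec v, fun a u h => supp221_weight a u v ?_⟩
  by_contra hs
  exact h (by simp [T221, hs])

/-- `P ≤ E_c` for every code `c` (the slices vanish off their support and satisfy both ties). -/
theorem Psub_le_Eeq (c : ℕ) : Psub K ≤ Eeq K c := by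
  refine Submodule.span_le.2 ?_
  rintro _ ⟨v, rfl⟩
  refine mem_Eeq.2 ⟨fun p hp => ?_, fun _ => ?_, fun _ => ?_⟩
  · have h := supp221_of_suppPN p v (of_zcondN hp).1
    simp [sliceV, T221, h]
  · simp [sliceV, T221, supp221_tie1 v]
  · simp [sliceV, T221, supp221_tie2 v]

/-- The four slices are linearly independent. -/
theorem linearIndependent_sliceV : LinearIndependent K (sliceV K) := by
  refine linearIndependent_of_triangular (sliceV K) diagCell (fun t => ?_) (fun s t hst => ?_)
  · simp [sliceV, T221, supp221_diag t]
  · simp [sliceV, T221, supp221_offdiag s t hst]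

/-- `dim P = 4`. -/
theorem finrank_Psub : Module.finrank K (Psub K) = 4 := by
  rw [Psub, finrank_span_eq_card (linearIndependent_sliceV K), Fintype.card_fin]

/-- A vector is the sum of its weight components. -/
theorem eq_sum_projDeg (x : Fin 5 × Fin 4 → K) :
    x = ∑ d ∈ (Finset.univ : Finset (Fin 5 × Fin 4)).image (degIK eAF eBF),
      projDeg (degIK eAF eBF) d x := by
  funext s
  rw [Finset.sum_apply]
  simp only [projDeg_apply]
  rw [Finset.sum_ite_eq, if_pos (Finset.mem_image_of_mem _ (Finset.mem_univ s))]

/-- **The torus reduction to twenty candidates.** A graded subspace `E ⊆ K^{A × U}` of dimension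
`≤ 5` containing the four slices is contained in `E_c` for some code `c < 20`: either `E = P`, or
`E = P ⊕ K x'` for a weight vector `x' ∉ P` of degree `d = deg s₀` (`x' s₀ ≠ 0`), and then every
coordinate of `E` off `supp P` of degree `≠ d` vanishes, while a tie of `P` persists unless `d` is
the common degree of its two coordinates. -/
theorem exists_le_Eeq (E : Submodule K (Fin 5 × Fin 4 → K)) (hdim : Module.finrank K E ≤ 5)
    (hsl : ∀ v, sliceV K v ∈ E)
    (hgr : ∀ d, ∀ x ∈ E, projDeg (degIK eAF eBF) d x ∈ E) :
    ∃ c < 20, E ≤ Eeq K c := by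
  set deg := degIK eAF eBF with hdeg_def
  have hP : Psub K ≤ E := Submodule.span_le.2 (Set.range_subset_iff.2 hsl)
  by_cases hEP : E ≤ Psub K
  · exact ⟨0, by norm_num, hEP.trans (Psub_le_Eeq K 0)⟩
  obtain ⟨x, hxE, hxP⟩ := SetLike.not_le_iff_exists.1 hEP
  have hx := eq_sum_projDeg K x
  have hex : ∃ d ∈ (Finset.univ : Finset (Fin 5 × Fin 4)).image deg, projDeg deg d x ∉ Psub K := by
    by_contra hall
    push Not at hall
    exact hxP (hx ▸ Submodule.sum_mem _ hall)
  obtain ⟨d, -, hd⟩ := hex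
  set x' := projDeg deg d x with hx'_def
  have hx'E : x' ∈ E := hgr d x hxE
  have hne : x' ≠ 0 := by
    intro h
    exact hd (by rw [h]; exact Submodule.zero_mem _)
  obtain ⟨s₀, hs₀⟩ := Function.ne_iff.1 hne
  have hds₀ : deg s₀ = d := by
    by_contra h
    exact hs₀ (by simp [hx'_def, projDeg_apply, h])
  refine ⟨codeP s₀, codeP_lt s₀, ?_⟩
  have hle : Psub K ⊔ K ∙ x' ≤ E :=
    sup_le hP ((Submodule.span_singleton_le_iff_mem x' E).2 hx'E)
  have hlt : Psub K < Psub K ⊔ K ∙ x' :=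
    left_lt_sup.2 fun h => hd ((Submodule.span_singleton_le_iff_mem _ _).1 h)
  have h5 : 5 ≤ Module.finrank K ↥(Psub K ⊔ K ∙ x') := by
    have h1 := Submodule.finrank_lt_finrank_of_lt hlt
    rw [finrank_Psub] at h1
    omega
  have hEeq : E = Psub K ⊔ K ∙ x' := (Submodule.eq_of_le_of_finrank_le hle (hdim.trans h5)).symm
  rw [hEeq]
  refine sup_le (Psub_le_Eeq K _) ((Submodule.span_singleton_le_iff_mem _ _).2 ?_)
  -- `x'` satisfies the equations of `E_{codeP s₀}`
  have hoff : ∀ p : Fin 5 × Fin 4, degN (codeP p) ≠ degN (codeP s₀) → x' p = 0 := by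
    intro p hp
    have hne' : deg p ≠ d := by
      rw [← hds₀, hdeg_def, degIK_eq, degIK_eq]
      exact_mod_cast hp
    simp [hx'_def, projDeg_apply, hne']
  obtain ⟨d00, d21, d10, d31⟩ := degN_ties
  refine mem_Eeq.2 ⟨fun p hp => hoff p (of_zcondN hp).2, fun h => ?_, fun h => ?_⟩
  · have h' : degN (codeP s₀) ≠ 1 := by simpa using h
    rw [hoff _ (by rw [d00]; exact Ne.symm h'), hoff _ (by rw [d21]; exact Ne.symm h')]
  · have h' : degN (codeP s₀) ≠ 4 := by simpa using h
    rw [hoff _ (by rw [d10]; exact Ne.symm h'), hoff _ (by rw [d31]; exact Ne.symm h')]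

/-! ## The lower bound -/

/-- **`6 ≤ bR(⟨2,1,2⟩ ⊕ ⟨1,2,1⟩)` over every field**, for the coordinate tensor `T221`
(algebraic border rank over `K[ε]`, Bläser 2013 Def. 6.1). -/
theorem six_le_algBorderRank_T221 : 6 ≤ algBorderRank (T221 K) := by
  by_contra hlt
  rw [not_le] at hlt
  obtain ⟨h, hh⟩ := exists_algBorderRank_eq_approxRank (T221 K)
  have h5 : approxRank h (T221 K) ≤ 5 := by omega
  obtain ⟨u, v, w, hd⟩ := exists_isApproxDecomposition_of_approxRank_le h5
  have hpt : Function.Injective (fun ρ : Fin 5 => ((ρ, 0) : Fin 5 × Fin 4)) :=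
    fun ρ ρ' e => (Prod.mk.inj e).1
  obtain ⟨E, hdim, hsl, hI, -, hgr⟩ := exists_graded_candidate_of_isApproxDecomposition eAF eBF hd
    _ hpt (W := 17) eAF_lt eBF_lt (T221_homogeneous K)
  obtain ⟨c, hc, hE⟩ := exists_le_Eeq K E hdim hsl hgr
  have h4 := finrank_testI_Eeq_le K (checkN_all c hc)
  have hmono := Submodule.finrank_mono (testI_mono hE)
  omega

/-- `T221` is the coordinate restriction of `matMulDirectSum ℂ ![2,1] ![1,2] ![2,1]` along
`(fA, gU, kV)`. -/
theorem T221_eq_precomp :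
    (fun a b c => matMulDirectSum ℂ ![2, 1] ![1, 2] ![2, 1] (fA a) (gU b) (kV c)) = T221 ℂ := by
  funext a b c
  simp only [matMulDirectSum, T221]
  exact if_congr (matMulDirectSum_cond_iff a b c) rfl rfl

end SchonhageTightTwoTwo

open Literature.Computability.AlgebraicComplexity SchonhageTightTwoTwo in
/-- **Item `SchonhageTightTwoTwo` (stmt-MatrixMultiplication-8009): `bR(⟨2,1,2⟩ ⊕ ⟨1,2,1⟩) ≥ 6`** for
the tree's algebraic border rank over `ℂ[ε]` — Schönhage's one free scalar product next to a `2 × 2`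
outer product is optimal; the kissing cell `(2,2)` of `KissingBeyondSchonhage` is closed negatively
(so the border rank equals the rank `6`). -/
theorem schonhageTightTwoTwo_proof :
    Summit.MatrixMultiplication.MatrixMultiplication.Theses.TropicalBiniPatterns.SchonhageTightTwoTwo := by
  unfold Theses.TropicalBiniPatterns.SchonhageTightTwoTwo
  calc 6 ≤ algBorderRank (T221 ℂ) := six_le_algBorderRank_T221 ℂ
    _ = algBorderRank (fun a b c => matMulDirectSum ℂ ![2, 1] ![1, 2] ![2, 1] (fA a) (gU b) (kV c)) := by
        rw [T221_eq_precomp]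
    _ ≤ algBorderRank (matMulDirectSum ℂ ![2, 1] ![1, 2] ![2, 1]) :=
        algBorderRank_precomp_le _ fA gU kV

end Summit.MatrixMultiplication.MatrixMultiplication.Theorems
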